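import Summits.ResolutionOfSingularities.ResolutionOfSingularities.Theorems.MarkedTransferCampaignW46MohWindowSurfaceFrozenShape
import Mathlib.Algebra.CharP.Lemmas
import HarnessLib

/-!
# [OURS · L1 W4.6 rung (iii-2), HEAVY-ROOT SIDE, `p = 2`] Surface Moh window — the CHILD OF A CUBE POINT: cleaning, the shape
# `(w² + s²η + s q³ G)`, and the degenerate case (cell res-hironaka, LADDER-RESOLUTION rung L, D-0089; seat res-L1-s46-pv-5 gen 4;
# host MarkedTransfer, `--supports stmt-ResolutionOfSingularities-16155 --as helper`; statement file `…CampaignW46MohWindowSurface.lean`)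

HONEST FRAMING. Nothing here is a statement of H. Hironaka's manuscript [Hironaka2017] and nothing here asserts that any
statement of it holds. PURE COMMUTATIVE ALGEBRA over a regular local ring `L` of embedding dimension `3` and characteristic `2`; step
(3) of res-L1-s46-pv-5's «p = 2 programme» (NOTES), on top of `…FormTransfer.lean` / `…FrozenShape.lean`. AI-written; AI review is
weaker than expert review. No `sorry`; axioms standard.

THE POINT. At `p = 2` a point `ξ′` of the blow-up lying over a TRIPLE root of the residue cubic of a window point has, in the chart
parameters `(t, ρ, e₂)` (res-D-pv-050's `exists_core_data_of_factor` with multiplicity `3`), `J′ = (e₂² + t·F)` with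
`F = ρ³ G + t H₀`, `G` a unit. If `J′` carries a window presentation at all (the next stage is in the regime), then
`H̄₀` is a square: `H₀ ≡ σ² (mod 𝔪)` (`exists_sq_congr_of_window`, degree-two quasi-regularity + Frobenius), and with the CLEANED
letter `w = e₂ + σ t` one has `J′ = (w² + t² η + t ρ³ G)`, `η = H₀ − σ² ∈ 𝔪`, `(t, ρ, w)` a regular system of parameters
(`cubeChild_shape`): the «cube-child shape» `(w² + s² η + s q³ G)`. Writing `η = η_S s + η_Q q + η_W w`: if `η_Q` is a unit the point
is FROZEN (`…FrozenShape.lean` + `…Freeze.lean`: never an admitted centre); if `η_S, η_Q ∈ 𝔪` the point has NO coefficient window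
presentation at all (`not_window_of_degenerate`, so an in-regime sequence never meets it); the remaining PURE case (`η_Q ∈ 𝔪`, `η_S`
a unit: residue cubic `c · S³`, heavy direction = the exceptional curve) is the one whose children are all frozen (companion
`…PureChild.lean`). [ZariskiSamuel1960] [Matsumura1987] [HauserWagner2014]
-/

noncomputable section

set_option linter.dupNamespace false -- mandated namespace of this single-conjunct summit

namespace Summit.ResolutionOfSingularities.ResolutionOfSingularities.Theorems.CampaignW46.MohWindowSurface

open IsLocalRing
open Literature.AlgebraicGeometry.Resolution
open Summit.ResolutionOfSingularities.ResolutionOfSingularities.Theorems.CampaignW46.MohWindowSurfaceResidualOrder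

universe u

variable {L : Type u} [CommRing L] [IsRegularLocalRing L] [CharP L 2]

/-! ## 1. Cleaning: the constant term of `H₀` is a square -/

/-- **[OURS · L1 W4.6 rung (iii-2), `p = 2`] CLEANING.** `L` regular local of embedding dimension `3`, characteristic `2`, regular
system of parameters `(t, ρ, e₂)`; if `(e₂² + t² H₀ + r₃) = (z₁² + f₁)` with `r₃, f₁ ∈ 𝔪³`, `z₁ ∈ 𝔪` (a window presentation of the
same ideal exists), then `H₀ − σ² ∈ 𝔪` for some `σ`: writing `z₁ = αt + βρ + λe₂`, Frobenius and degree-two quasi-regularity give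
`u ≡ λ²`, `u H₀ ≡ α²`, so `σ = α/λ`. NOT a statement of the manuscript. [folklore] -/
theorem exists_sq_congr_of_window (h3 : (maximalIdeal L).spanFinrank = 3) {t ρ e₂ : L}
    (hgen : Ideal.span {t, ρ, e₂} = maximalIdeal L) {H₀ r₃ z₁ f₁ : L} (hr₃ : r₃ ∈ maximalIdeal L ^ 3)
    (hz₁ : z₁ ∈ maximalIdeal L) (hf₁ : f₁ ∈ maximalIdeal L ^ 3)
    (heq : Ideal.span {e₂ ^ 2 + (t ^ 2 * H₀ + r₃)} = Ideal.span {z₁ ^ 2 + f₁}) :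
    ∃ σ : L, H₀ - σ ^ 2 ∈ maximalIdeal L := by
  have hR : IsRegularLocalRing L := inferInstance
  haveI := isDomain_of_isRegularLocalRing L
  obtain ⟨u, hu⟩ := Ideal.span_singleton_eq_span_singleton.mp heq
  have hz₁' : z₁ ∈ Ideal.span ({t, ρ, e₂} : Set L) := hgen ▸ hz₁
  obtain ⟨α, rest, hrest, hz₁eq⟩ := Ideal.mem_span_insert.mp hz₁'
  obtain ⟨β, lam, rfl⟩ := Ideal.mem_span_pair.mp hrest
  have hfrob : z₁ ^ 2 = (α * t) ^ 2 + (β * ρ) ^ 2 + (lam * e₂) ^ 2 := by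
    rw [hz₁eq, show α * t + (β * ρ + lam * e₂) = α * t + β * ρ + lam * e₂ from by ring, add_add_pow_char 2]
  -- the degree-two combination `(uH₀ − α²) t² + (−β²) ρ² + (u − λ²) e₂² = f₁ − u r₃ ∈ 𝔪³`
  have hcomb : (↑u * H₀ - α ^ 2) * t ^ 2 + (-(β ^ 2)) * ρ ^ 2 + (↑u - lam ^ 2) * e₂ ^ 2 ∈ maximalIdeal L ^ (2 + 1) := by
    have : (↑u * H₀ - α ^ 2) * t ^ 2 + (-(β ^ 2)) * ρ ^ 2 + (↑u - lam ^ 2) * e₂ ^ 2 = f₁ - ↑u * r₃ := by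
      have h1 : (e₂ ^ 2 + (t ^ 2 * H₀ + r₃)) * ↑u = z₁ ^ 2 + f₁ := hu
      rw [hfrob] at h1
      linear_combination h1
    rw [this]
    exact Ideal.sub_mem _ hf₁ (Ideal.mul_mem_left _ _ hr₃)
  obtain ⟨hH, -, hul⟩ := coeffs_mem_of_pow_combination_mem hR h3 hgen two_ne_zero hcomb
  -- `λ` is a unit
  have hlam : IsUnit lam := by
    by_contra h
    have hl : lam ^ 2 ∈ maximalIdeal L :=
      Ideal.pow_mem_of_mem _ ((mem_maximalIdeal _).mpr (mem_nonunits_iff.mpr h)) 2 two_pos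
    have : (↑u : L) ∈ maximalIdeal L := by
      have := Ideal.add_mem _ hul hl; rwa [sub_add_cancel] at this
    exact (maximalIdeal.isMaximal L).ne_top (Ideal.eq_top_of_isUnit_mem _ this (Units.isUnit u))
  obtain ⟨lam', hlam'⟩ := hlam.exists_left_inv
  refine ⟨α * lam', ?_⟩
  -- `H₀ − (α λ')² = λ'² ((λ² − u) H₀ + (u H₀ − α²))`
  have : H₀ - (α * lam') ^ 2 = lam' ^ 2 * ((lam ^ 2 - ↑u) * H₀ + (↑u * H₀ - α ^ 2)) := by
    have h1 : lam' * lam = 1 := hlam'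
    have h2 : lam' ^ 2 * lam ^ 2 = 1 := by rw [← mul_pow, h1, one_pow]
    linear_combination (-H₀) * h2
  rw [this]
  refine Ideal.mul_mem_left _ _ (Ideal.add_mem _ (Ideal.mul_mem_right _ _ ?_) hH)
  have := neg_mem hul
  rwa [neg_sub] at this

/-! ## 2. The cube-child shape after cleaning -/

omit [IsRegularLocalRing L] in
/-- **[OURS · L1 W4.6 rung (iii-2), `p = 2`] THE CUBE-CHILD SHAPE.** With `(t, ρ, e₂)` generating `𝔪`, `F − ρ³G ∈ (t)` and a
cleaning constant `σ` (`F = ρ³ G + t H₀`, `H₀ − σ² ∈ 𝔪`): the letter `w = e₂ + σ t` completes `(t, ρ)` to a generating triple and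
`e₂² + t F = w² + (t² η + t ρ³ G)` with `η = H₀ − σ² ∈ 𝔪` written EXACTLY as `η = η_S t + η_Q ρ + η_W w`, and `t ρ³ G ∈ 𝔪⁴`. NOT a
statement of the manuscript. [folklore] -/
theorem cubeChild_shape [IsLocalRing L] {t ρ e₂ : L} (hgen : Ideal.span {t, ρ, e₂} = maximalIdeal L) {F G H₀ σ : L}
    (hF : F = ρ ^ 3 * G + t * H₀) (hσ : H₀ - σ ^ 2 ∈ maximalIdeal L) :
    ∃ η η_S η_Q η_W : L, Ideal.span {t, ρ, e₂ + σ * t} = maximalIdeal L ∧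
      e₂ ^ 2 + t * F = (e₂ + σ * t) ^ 2 + (t ^ 2 * η + t * ρ ^ 3 * G) ∧ η ∈ maximalIdeal L ∧
      η - (η_S * t + η_Q * ρ + η_W * (e₂ + σ * t)) ∈ maximalIdeal L ^ 2 ∧ η = H₀ - σ ^ 2 ∧
      t * ρ ^ 3 * G ∈ maximalIdeal L ^ 4 := by
  have ht : t ∈ maximalIdeal L := hgen ▸ Ideal.subset_span (by simp)
  have hρ : ρ ∈ maximalIdeal L := hgen ▸ Ideal.subset_span (by simp)
  -- the new triple generates `𝔪`
  have hgen' : Ideal.span {t, ρ, e₂ + σ * t} = maximalIdeal L := by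
    rw [← hgen]
    apply le_antisymm
    · rw [Ideal.span_le]
      rintro c (rfl | rfl | rfl)
      · exact Ideal.subset_span (by simp)
      · exact Ideal.subset_span (by simp)
      · exact Ideal.add_mem _ (Ideal.subset_span (by simp)) (Ideal.mul_mem_left _ _ (Ideal.subset_span (by simp)))
    · rw [Ideal.span_le]
      rintro c (rfl | rfl | rfl)
      · exact Ideal.subset_span (by simp)
      · exact Ideal.subset_span (by simp)
      · have : c = (c + σ * t) - σ * t := by ring
        rw [SetLike.mem_coe, this]
        exact Ideal.sub_mem _ (Ideal.subset_span (by simp)) (Ideal.mul_mem_left _ _ (Ideal.subset_span (by simp)))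
  -- `η = H₀ − σ²` expanded exactly in the new triple
  have hηm : H₀ - σ ^ 2 ∈ Ideal.span ({t, ρ, e₂ + σ * t} : Set L) := hgen' ▸ hσ
  obtain ⟨η_S, rest, hrest, hηeq⟩ := Ideal.mem_span_insert.mp hηm
  obtain ⟨η_Q, η_W, rfl⟩ := Ideal.mem_span_pair.mp hrest
  refine ⟨H₀ - σ ^ 2, η_S, η_Q, η_W, hgen', ?_, hσ, ?_, rfl, ?_⟩
  · rw [hF, add_pow_char]; ring
  · rw [show H₀ - σ ^ 2 - (η_S * t + η_Q * ρ + η_W * (e₂ + σ * t)) = 0 from by rw [hηeq]; ring]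
    exact zero_mem _
  · have : t * ρ ^ 3 * G ∈ maximalIdeal L ^ 4 := by
      have h1 := Ideal.mul_mem_mul ht (Ideal.pow_mem_pow hρ 3)
      rw [← pow_succ'] at h1
      exact Ideal.mul_mem_right _ _ h1
    exact this

/-! ## 3. The degenerate case carries no window presentation -/

/-- **[OURS · L1 W4.6 rung (iii-2), `p = 2`] THE DEGENERATE CUBE CHILD HAS NO WINDOW PRESENTATION.** If
`J = (w² + s²η + r)` with `η ≡ η_S s + η_Q q + η_W w (mod 𝔪²)`, BOTH `η_S, η_Q ∈ 𝔪`, `r ∈ 𝔪⁴`, then `J` has NO coefficient window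
presentation `(z² + Σ_{k ≤ 3} a_k x^{3−k} y^k)` with a unit among the `a_k` (by the transfer all `ā_k` vanish) — such a point is
singular but outside the regime. NOT a statement of the manuscript. [folklore] -/
theorem not_window_of_degenerate (h3 : (maximalIdeal L).spanFinrank = 3) {s q w : L}
    (hsqw : Ideal.span {s, q, w} = maximalIdeal L) {η r η_S η_Q η_W : L}
    (hη : η - (η_S * s + η_Q * q + η_W * w) ∈ maximalIdeal L ^ 2) (hηS : η_S ∈ maximalIdeal L)
    (hηQ : η_Q ∈ maximalIdeal L) (hr : r ∈ maximalIdeal L ^ 4) {x y z : L} (hxyz : Ideal.span {x, y, z} = maximalIdeal L)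
    {a : ℕ → L} (hunit : ∃ j ≤ 3, IsUnit (a j))
    (heq : Ideal.span {w ^ 2 + (s ^ 2 * η + r)} = Ideal.span {z ^ 2 + ∑ k ∈ Finset.range (3 + 1), a k * x ^ (3 - k) * y ^ k}) :
    False := by
  obtain ⟨u, a₁, a₂, a₃, b₁, b₂, b₃, ν₁, ν₂, -, -, -, -, hν₁, hν₂, h0, h1, h2, h3'⟩ :=
    frozenShape_coeff_congr h3 hsqw hη hr hxyz a heq
  have hν₁m : ν₁ ∈ maximalIdeal L := by
    have : ν₁ = (ν₁ - (η_S * a₁ + η_Q * b₁)) + (η_S * a₁ + η_Q * b₁) := by ring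
    rw [this]
    exact Ideal.add_mem _ hν₁ (Ideal.add_mem _ (Ideal.mul_mem_right _ _ hηS) (Ideal.mul_mem_right _ _ hηQ))
  have hν₂m : ν₂ ∈ maximalIdeal L := by
    have : ν₂ = (ν₂ - (η_S * a₂ + η_Q * b₂)) + (η_S * a₂ + η_Q * b₂) := by ring
    rw [this]
    exact Ideal.add_mem _ hν₂ (Ideal.add_mem _ (Ideal.mul_mem_right _ _ hηS) (Ideal.mul_mem_right _ _ hηQ))
  have key : ∀ {c e : L}, c - u * e ∈ maximalIdeal L → e ∈ maximalIdeal L → c ∈ maximalIdeal L := by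
    intro c e hce he
    have : c = (c - u * e) + u * e := by ring
    rw [this]
    exact Ideal.add_mem _ hce (Ideal.mul_mem_left _ _ he)
  have ha : ∀ j ≤ 3, a j ∈ maximalIdeal L := by
    intro j hj
    interval_cases j
    · exact key h0 (Ideal.mul_mem_left _ _ hν₁m)
    · exact key h1 (Ideal.add_mem _ (Ideal.mul_mem_left _ _ hν₂m) (Ideal.mul_mem_left _ _ hν₁m))
    · exact key h2 (Ideal.add_mem _ (Ideal.mul_mem_left _ _ hν₁m) (Ideal.mul_mem_left _ _ hν₂m))
    · exact key h3' (Ideal.mul_mem_left _ _ hν₂m)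
  obtain ⟨j, hj, hju⟩ := hunit
  exact (maximalIdeal.isMaximal L).ne_top (Ideal.eq_top_of_isUnit_mem _ (ha j hj) hju)

end Summit.ResolutionOfSingularities.ResolutionOfSingularities.Theorems.CampaignW46.MohWindowSurface

end
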